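import Summits.QuantumFields.YangMills.Theorems.ConvexGribovBodyNonSimplyConnectedLatticeGapWeakMixingFunnel
import Summits.QuantumFields.YangMills.Theorems.ConvexGribovBodyNonSimplyConnectedLatticeGapStubCorrPullbackCover
import Literature.Probability.LatticeModels.ONModelProofs
import HarnessLib

/-!
# Crux `NonSimplyConnectedLatticeGap` (stmt-QuantumFields-16405), route `ConvexGribovBody`,
# line `Sketch` (v6) — stub `stub_boxInfluence_of_cover` (KC: the kernel-level cover identity)

"On a cube there are no flux sectors." For a continuous SURJECTIVE homomorphism `π : H →* G` of
compact metrisable groups (the case in point is the universal cover `SU(2) → SO(3) = SU(2)/{±1}`),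
a continuous matrix representation `ρ` of `G`, a coupling `β`, a finite set of links `Λ ⊆ ℤᵈ-edges`
and an `H`-valued exterior configuration `ζ`, the lattice Yang–Mills DLR kernel of the covering
theory `(H, ρ ∘ π)` pushes forward EXACTLY to the kernel of the `(G, ρ)` theory under the link-wise
map `Φ V = π ∘ V`:

`Φ_* γ^{ρ∘π}_Λ(· | ζ) = γ^{ρ}_Λ(· | π ∘ ζ)`     (`map_ymSpecification_comp_of_surjective`).

Ingredients (all at the level of `ymSpecification ρ β Λ η = ((Haar_G^{⊗Λ}).map (glueWith Λ · η)).tilted (-β S_Λ)`):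

* `π` maps plaquette holonomies to plaquette holonomies, so the boundary Wilson action of the
  covering theory is the pull-back of the `G`-action, `S^{ρ∘π}_Λ(V) = S^{ρ}_Λ(π ∘ V)`
  (`coverKernel_plaquetteHolonomyZd_comp`, `coverKernel_wilsonBoundaryAction_comp`);
* gluing commutes with the link-wise map, `π ∘ (ξ ζ_{Λᶜ}) = (π ∘ ξ) (π ∘ ζ)_{Λᶜ}`
  (`coverKernel_glueWith_comp`);
* `π_* Haar_H = Haar_G` for a continuous surjective homomorphism onto a compact group (K1,
  `measurePreserving_haarProbability_of_surjective`), hence `Φ'_* Haar_H^{⊗Λ} = Haar_G^{⊗Λ}` for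
  `Φ' ξ = π ∘ ξ` on `Λ`-configurations (`coverKernel_map_pi_haarProbability_comp`, Mathlib
  `measurePreserving_pi`);
* push-forward commutes with tilting, `Φ_* (μ.tilted (g ∘ Φ)) = (Φ_* μ).tilted g`
  (tree lemma `Literature.Probability.LatticeModels.map_tilted_comp`, `ONModelProofs.lean`).

Consequently (`integral_ymSpecification_comp_of_surjective`) the kernel expectation of a pulled-back
observable `A ∘ Φ` in the covering theory with exterior data `ζ` is the `(G, ρ)`-kernel expectation
of `A` with exterior data `π ∘ ζ`, and — lifting arbitrary `G`-exterior data `η, η'` along the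
surjection `π` — any profile `δ` bounding the cube influences of `A ∘ Φ` in the `(H, ρ ∘ π)` theory
bounds the cube influences of `A` in the `(G, ρ)` theory (`stub_boxInfluence_of_cover`). For
`G = SO(3)`: weak mixing on cubes of the ADJOINT-action `SU(2)` theory gives the leaf for `SO(3)`.
-/

set_option autoImplicit false

noncomputable section

open MeasureTheory

namespace Summit.QuantumFields.YangMills.Theorems.NonSimplyConnectedLatticeGap

open Literature.Probability.LatticeModels
open Literature.MathematicalPhysics.QuantumLattice
open Literature.MathematicalPhysics.QuantumFieldTheory (haarProbability)

section Transport

variable {d N : ℕ} {G H : Type*} [Group G] [Group H]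

/-- **A homomorphism applied link-wise maps `ℤᵈ` plaquette holonomies to plaquette holonomies**:
`U_p(π ∘ V) = π (U_p(V))` (`π` is multiplicative and commutes with inversion; the `ℤᵈ` analogue of
the torus lemma `corrPullback_plaquetteHolonomy_comp`). [folklore] -/
theorem coverKernel_plaquetteHolonomyZd_comp (π : H →* G) (V : LGConfig d H) (x : Site d)
    (i j : Fin d) :
    plaquetteHolonomyZd (fun e => π (V e)) x i j = π (plaquetteHolonomyZd V x i j) := by
  simp only [plaquetteHolonomyZd, map_mul, map_inv]

/-- **The boundary Wilson action of the covering theory is the pull-back of the `G`-action**: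
`S^{ρ∘π}_Λ(V) = S^{ρ}_Λ(π ∘ V)` (plaquette by plaquette, `coverKernel_plaquetteHolonomyZd_comp`).
[folklore] -/
theorem coverKernel_wilsonBoundaryAction_comp (π : H →* G) (ρ : G →* Matrix (Fin N) (Fin N) ℂ)
    (Λ : Finset (ZdEdge d)) (V : LGConfig d H) :
    wilsonBoundaryAction (ρ.comp π) Λ V = wilsonBoundaryAction ρ Λ (fun e => π (V e)) := by
  unfold wilsonBoundaryAction
  refine Finset.sum_congr rfl fun p _ => ?_
  rw [plaquetteObs, plaquetteObs, coverKernel_plaquetteHolonomyZd_comp, MonoidHom.comp_apply]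

omit [Group G] [Group H] in
/-- **Gluing commutes with any link-wise map**: `f ∘ (ξ ζ_{Λᶜ}) = (f ∘ ξ) (f ∘ ζ)_{Λᶜ}` (split on
`e ∈ Λ`). [folklore] -/
theorem coverKernel_glueWith_comp (f : H → G) (Λ : Finset (ZdEdge d)) (ξ : ↥Λ → H)
    (ζ : LGConfig d H) :
    (fun e => f (glueWith Λ ξ ζ e)) = glueWith Λ (fun i => f (ξ i)) (fun e => f (ζ e)) := by
  funext e
  by_cases he : e ∈ Λ
  · simp only [glueWith_apply_mem _ _ _ he]
  · simp only [glueWith_apply_not_mem _ _ _ he]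

variable [TopologicalSpace G] [IsTopologicalGroup G] [CompactSpace G] [MeasurableSpace G]
  [BorelSpace G] [TopologicalSpace H] [IsTopologicalGroup H] [CompactSpace H] [MeasurableSpace H]
  [BorelSpace H]

omit [Group G] [Group H] [IsTopologicalGroup G] [CompactSpace G] [IsTopologicalGroup H]
  [CompactSpace H] in
/-- The link-wise map `V ↦ π ∘ V` of `ℤᵈ`-configurations is measurable for a continuous `π`.
[folklore] -/
theorem coverKernel_measurable_comp (π : H → G) (hπ : Continuous π) :
    Measurable fun (V : LGConfig d H) (e : ZdEdge d) => π (V e) :=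
  measurable_pi_lambda _ fun e => hπ.measurable.comp (measurable_pi_apply e)

/-- **The finite Haar product over the links of `Λ` is transported** by the link-wise map:
`Φ'_* Haar_H^{⊗Λ} = Haar_G^{⊗Λ}` for `Φ' ξ = π ∘ ξ` (K1 `measurePreserving_haarProbability_of_surjective`
link by link, Mathlib `measurePreserving_pi`). [folklore] -/
theorem coverKernel_map_pi_haarProbability_comp (Λ : Finset (ZdEdge d)) (π : H →* G)
    (hπ : Continuous π) (hsurj : Function.Surjective π) :
    (Measure.pi fun _ : ↥Λ => haarProbability H).map (fun (ξ : ↥Λ → H) (i : ↥Λ) => π (ξ i)) =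
      Measure.pi fun _ : ↥Λ => haarProbability G :=
  (measurePreserving_pi (fun _ : ↥Λ => haarProbability H) (fun _ : ↥Λ => haarProbability G)
    (fun _ => measurePreserving_haarProbability_of_surjective π hπ hsurj)).map_eq

variable [SecondCountableTopology G]

/-- **KC, kernel level — the covering kernel pushes forward exactly to the kernel ("on a cube there
are no flux sectors")**: for a continuous surjective homomorphism `π : H →* G` of compact groups, a
continuous representation `ρ` of `G`, every `β`, every finite link set `Λ` and every `H`-valued
exterior configuration `ζ`,
`(γ^{ρ∘π}_Λ(· | ζ)).map (π ∘ ·) = γ^{ρ}_Λ(· | π ∘ ζ)` for `γ = ymSpecification`.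
Proof: the tilt density of the covering kernel is the pull-back of the `G`-density
(`coverKernel_wilsonBoundaryAction_comp`), push-forward commutes with tilting
(`map_tilted_comp`), and the glued reference measures correspond because gluing commutes
with the link-wise map (`coverKernel_glueWith_comp`) and `π` transports the Haar product
(`coverKernel_map_pi_haarProbability_comp`). [folklore] -/
theorem map_ymSpecification_comp_of_surjective (π : H →* G) (hπ : Continuous π)
    (hsurj : Function.Surjective π) (ρ : G →* Matrix (Fin N) (Fin N) ℂ) (hρ : Continuous ρ)
    (β : ℝ) (Λ : Finset (ZdEdge d)) (ζ : LGConfig d H) :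
    (ymSpecification (ρ.comp π) β Λ ζ).map (fun (V : LGConfig d H) (e : ZdEdge d) => π (V e)) =
      ymSpecification ρ β Λ (fun e => π (ζ e)) := by
  have hΦ : Measurable fun (V : LGConfig d H) (e : ZdEdge d) => π (V e) :=
    coverKernel_measurable_comp π hπ
  have hΦ' : Measurable fun (ξ : ↥Λ → H) (i : ↥Λ) => π (ξ i) :=
    measurable_pi_lambda _ fun i => hπ.measurable.comp (measurable_pi_apply i)
  have hgH : Measurable fun ξ : ↥Λ → H => glueWith Λ ξ ζ := measurable_glueWith Λ ζ
  have hgG : Measurable fun ξ : ↥Λ → G => glueWith Λ ξ (fun e => π (ζ e)) :=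
    measurable_glueWith Λ _
  have hS : Measurable fun U : LGConfig d G => -β * wilsonBoundaryAction ρ Λ U :=
    (continuous_const.mul (continuous_wilsonBoundaryAction ρ hρ Λ)).measurable
  -- the tilt density of the covering kernel is the pull-back of the `G`-density
  have hcomp : (fun V : LGConfig d H => -β * wilsonBoundaryAction (ρ.comp π) Λ V) =
      (fun U : LGConfig d G => -β * wilsonBoundaryAction ρ Λ U) ∘
        fun (V : LGConfig d H) (e : ZdEdge d) => π (V e) := by
    funext V
    simp only [Function.comp_apply, coverKernel_wilsonBoundaryAction_comp]
  -- gluing commutes with the link-wise map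
  have hglue : (fun (V : LGConfig d H) (e : ZdEdge d) => π (V e)) ∘
        (fun ξ : ↥Λ → H => glueWith Λ ξ ζ) =
      (fun ξ : ↥Λ → G => glueWith Λ ξ (fun e => π (ζ e))) ∘
        fun (ξ : ↥Λ → H) (i : ↥Λ) => π (ξ i) := by
    funext ξ
    exact coverKernel_glueWith_comp π Λ ξ ζ
  show (((Measure.pi fun _ : ↥Λ => haarProbability H).map fun ξ : ↥Λ → H => glueWith Λ ξ ζ).tilted
      fun V : LGConfig d H => -β * wilsonBoundaryAction (ρ.comp π) Λ V).map
        (fun (V : LGConfig d H) (e : ZdEdge d) => π (V e)) =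
    (((Measure.pi fun _ : ↥Λ => haarProbability G).map
        fun ξ : ↥Λ → G => glueWith Λ ξ (fun e => π (ζ e))).tilted
      fun U : LGConfig d G => -β * wilsonBoundaryAction ρ Λ U)
  rw [hcomp, map_tilted_comp _ hΦ hS, Measure.map_map hΦ hgH, hglue,
    ← Measure.map_map hgG hΦ', coverKernel_map_pi_haarProbability_comp Λ π hπ hsurj]

/-- **Kernel expectations of pulled-back observables agree**: for a measurable real observable `F`
of `G`-configurations, `∫ F (π ∘ V) dγ^{ρ∘π}_Λ(V | ζ) = ∫ F dγ^{ρ}_Λ(· | π ∘ ζ)` (change of variables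
along `map_ymSpecification_comp_of_surjective`). [folklore] -/
theorem integral_ymSpecification_comp_of_surjective (π : H →* G) (hπ : Continuous π)
    (hsurj : Function.Surjective π) (ρ : G →* Matrix (Fin N) (Fin N) ℂ) (hρ : Continuous ρ)
    (β : ℝ) (Λ : Finset (ZdEdge d)) (ζ : LGConfig d H) {F : LGConfig d G → ℝ}
    (hF : Measurable F) :
    ∫ V, F (fun e => π (V e)) ∂(ymSpecification (ρ.comp π) β Λ ζ) =
      ∫ U, F U ∂(ymSpecification ρ β Λ (fun e => π (ζ e))) := by
  rw [← map_ymSpecification_comp_of_surjective π hπ hsurj ρ hρ β Λ ζ,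
    integral_map (coverKernel_measurable_comp π hπ).aemeasurable hF.aestronglyMeasurable]

end Transport

/-- **STUB KC — cube influences descend along a cover.** For a continuous surjective homomorphism
`π : H →* G` of compact metrisable groups, a continuous representation `ρ` of `G`, a coupling `β`
and a local gauge-invariant observable `A` of `G`-configurations on `ℤ⁴`: if a profile `δ` bounds
the influence of the exterior data on the cube-kernel expectations of the pulled-back observable
`A ∘ (π ∘ ·)` in the covering theory `(H, ρ ∘ π)`, then `δ` bounds the influence of the exterior
data on the cube-kernel expectations of `A` in the `(G, ρ)` theory. Lift `η, η'` along the
surjection `π` (`Function.surjInv`) and use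
`∫ A (π ∘ V) dγ^{ρ∘π}_Λ(V | ζ) = ∫ A dγ^{ρ}_Λ(· | π ∘ ζ)` (`integral_ymSpecification_comp_of_surjective`,
from the kernel identity `map_ymSpecification_comp_of_surjective`). [folklore] -/
theorem stub_boxInfluence_of_cover : ∀ (G : Type) [Group G] [TopologicalSpace G] [IsTopologicalGroup G] [CompactSpace G] [MeasurableSpace G] [BorelSpace G] [SecondCountableTopology G] [T2Space G] (H : Type) [Group H] [TopologicalSpace H] [IsTopologicalGroup H] [CompactSpace H] [MeasurableSpace H] [BorelSpace H] [SecondCountableTopology H] [T2Space H] (π : H →* G), Continuous π → Function.Surjective π → ∀ (N : ℕ) (ρ : G →* Matrix (Fin N) (Fin N) ℂ), Continuous ρ → ∀ (β : ℝ) (A : Literature.MathematicalPhysics.QuantumLattice.LocalGaugeObservable 4 G) (δ : ℕ → ℝ), (∀ (L : ℕ) (ζ ζ' : Literature.MathematicalPhysics.QuantumLattice.LGConfig 4 H), |(∫ V, A.F (fun e => π (V e)) ∂(Literature.MathematicalPhysics.QuantumLattice.ymSpecification (ρ.comp π) β ((Fintype.piFinset fun _ : Fin 4 => Finset.Icc (-((L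 : ℕ) : ℤ)) ((L : ℕ) : ℤ)) ×ˢ (Finset.univ : Finset (Fin 4))) ζ)) - ∫ V, A.F (fun e => π (V e)) ∂(Literature.MathematicalPhysics.QuantumLattice.ymSpecification (ρ.comp π) β ((Fintype.piFinset fun _ : Fin 4 => Finset.Icc (-((L : ℕ) : ℤ)) ((L : ℕ) : ℤ)) ×ˢ (Finset.univ : Finset (Fin 4))) ζ')| ≤ δ L) → ∀ (L : ℕ) (η η' : Literature.MathematicalPhysics.QuantumLattice.LGConfig 4 G), |(∫ U, A.F U ∂(Literature.MathematicalPhysics.QuantumLattice.ymSpecification ρ β ((Fintype.piFinset fun _ : Fin 4 => Finset.Icc (-((L : ℕ) : ℤ)) ((L : ℕ) : ℤ)) ×ˢ (Finset.univ : Finset (Fin 4))) η)) - ∫ U, A.F U ∂(Literature.MathematicalPhysics.QuantumLattice.ymSpecification ρ β ((Fintype.piFinset fun _ : Fin 4 => Finset.Icc (-((L : ℕ) : ℤ)) ((L : ℕ) : ℤ)) ×ˢ (Finset.univ : Finset (Fin 4))) η')| ≤ δ L := by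
  intro G _ _ _ _ _ _ _ _ H _ _ _ _ _ _ _ _ π hπ hsurj N ρ hρ β A δ hδ L η η'
  -- lift the exterior data along the surjection `π`
  obtain ⟨ζ, rfl⟩ : ∃ ζ : LGConfig 4 H, (fun e => π (ζ e)) = η :=
    ⟨fun e => Function.surjInv hsurj (η e), funext fun e => Function.surjInv_eq hsurj (η e)⟩
  obtain ⟨ζ', rfl⟩ : ∃ ζ' : LGConfig 4 H, (fun e => π (ζ' e)) = η' :=
    ⟨fun e => Function.surjInv hsurj (η' e), funext fun e => Function.surjInv_eq hsurj (η' e)⟩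
  rw [← integral_ymSpecification_comp_of_surjective π hπ hsurj ρ hρ β _ ζ A.measurable,
    ← integral_ymSpecification_comp_of_surjective π hπ hsurj ρ hρ β _ ζ' A.measurable]
  exact hδ L ζ ζ'

end Summit.QuantumFields.YangMills.Theorems.NonSimplyConnectedLatticeGap

end
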